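import Summits.CriticalPhenomena.Ising3DConformalLimit.Theses.PerfectScreening
import Summits.CriticalPhenomena.Ising3DConformalLimit.Theses.EnergyNotSigmaSquared
import Summits.CriticalPhenomena.Ising3DConformalLimit.Theses.HyperoctahedralRP
import Summits.CriticalPhenomena.Ising3DConformalLimit.Theses.PositivityBegetsConformality
import Summits.CriticalPhenomena.Ising3DConformalLimit.Theorems.MoebiusLimitExists.Negative.MeshContinuity
import Summits.CriticalPhenomena.Ising3DConformalLimit.Theorems.PrecisionLaplacianMoebiusLimitOfTwoPointLawInversionBegetsRotations
import Summits.CriticalPhenomena.Ising3DConformalLimit.Theorems.EnergyNotSigmaSquaredMoebiusLimitExistsOneMapOneJetDefs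
import Summits.CriticalPhenomena.Ising3DConformalLimit.Theorems.EnergyNotSigmaSquaredMoebiusLimitExistsOneMapOneJetLowOrders
import Summits.CriticalPhenomena.Ising3DConformalLimit.Theorems.EnergyNotSigmaSquaredMoebiusLimitExistsOneMapOneJetDictionary
import Summits.CriticalPhenomena.Ising3DConformalLimit.Theorems.EnergyNotSigmaSquaredMoebiusLimitExistsOneMapOneJetDensity
import Summits.CriticalPhenomena.Ising3DConformalLimit.Theorems.EnergyNotSigmaSquaredMoebiusLimitExistsOneMapOneJetJetReduction
import HarnessLib

/-!
# Line `one-map-one-jet` (crux `MoebiusLimitExists`, stmt-CriticalPhenomena-1344): the reduction, hypothesis-free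
except for the two residual statements

With the density stub (`stub_invGoodConfig_dense`, p120310), the jet reduction (`stub_onePointJetReduction`,
p120309), the low-order analysis (`inversionDefect_eq_zero_of_lt_four_or_odd`, p120226), mesh continuity
(`LimitMeshContinuity.continuousOn_limit_of_translationInvariant`) and the group lemma (item 4675,
`PrecisionLaplacianMoebiusLimitOfTwoPointLaw.stub_inversionBegetsRotations`) all tree theorems, the line
`one-map-one-jet` reduces the crux to the existence item stmt-CriticalPhenomena-1981 and TWO statements about
1981-type limits (normalised, non-degenerate, translation-invariant, scale-covariant pointwise scaling limits of
the critical `ℤ³` correlators, NO rotations), spelled out verbatim below as hypotheses (they are the two open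
registered stubs of the skeleton `Cruxes/MoebiusLimitExists/Lines/one_map_one_jet.lean`, v4):

* (A) NINE-MIRROR ANALYTICITY — every such limit that is continuous off the diagonals is real-analytic on the
  good configurations `GoodConfig n` (`stub_nineMirrorAnalyticity`; Osterwalder–Schrader holomorphy in the
  nine lattice mirror directions + a separate-to-joint analyticity cross theorem; not in tree);
* (G) EVEN INVERSION GERMS — for every such analytic limit, at every even order `n ≥ 4`, every doubly-good
  configuration is joined inside `InvGoodConfig n` to a point where the inversion defect has vanishing germ
  (`stub_inversionGerm_even_ge_four`; the conjecture content, crux-implied: `stub_inversionGerm_even_ge_four_of_crux`).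

Main results: `isInversionCovariant_of_evenGerm` ((G)-instance + analyticity ⇒ inversion covariance of that
limit), `MoebiusLimitExists_of_analyticity_of_evenGerm` ((A) → (G) → 1981 → crux; registered anchor), and the
same for the primary spelling `EnergyNotSigmaSquared.MoebiusLimit`. Compare the sibling factorisation
`MoebiusLimitExists_iff_hrp` (crux ↔ 1981 ∧ 1980 ∧ 1982): here the rotation item 1980 and `HRP2Rigidity` do
not occur (inversion first, rotations from inversion + translations), at the price of the analyticity statement (A).
-/

noncomputable section

open Set Function Filter EuclideanGeometry
open scoped Topology
open Literature.Probability.LatticeModels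

namespace Summit.CriticalPhenomena.Ising3DConformalLimit.MoebiusLimitExistsOneMapOneJet

/-! ### The involution structure of the inversion defect (any family) -/

/-- The inversion weights of `x` and `ι x` are inverse to each other: `(∏‖ι x i‖^{2Δ}) (∏‖x i‖^{2Δ}) = 1`
off the pole. [cite: FrancescoMathieuSenechal1997, §4.1 eq. (4.15)] -/
theorem prod_norm_invCfg_rpow_mul {n : ℕ} (Δ : ℝ) {x : Fin n → EuclideanSpace ℝ (Fin 3)} (hx : ∀ i, x i ≠ 0) :
    (∏ i, ‖invCfg x i‖ ^ (2 * Δ)) * ∏ i, ‖x i‖ ^ (2 * Δ) = 1 := by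
  rw [← Finset.prod_mul_distrib]
  refine Finset.prod_eq_one fun i _ => ?_
  have h0 : 0 < ‖x i‖ := norm_pos_iff.2 (hx i)
  rw [invCfg_apply, inversion_zero_one_eq_smul, norm_smul, norm_inv, norm_pow, norm_norm,
    ← Real.mul_rpow (by positivity) h0.le]
  have : (‖x i‖ ^ 2)⁻¹ * ‖x i‖ * ‖x i‖ = 1 := by field_simp
  rw [show (‖x i‖ ^ 2)⁻¹ * ‖x i‖ = ‖x i‖⁻¹ by field_simp, inv_mul_cancel₀ h0.ne', Real.one_rpow]

/-- **`D ∘ ι = −(w ∘ ι) · D`**: the inversion defect of ANY family is anti-equivariant under the involution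
`ι` up to the (positive) weight — `D_n(ι x) = −(∏‖ι x i‖^{2Δ}) D_n(x)` off the pole. In particular the zero
set of `D_n` is `ι`-invariant, and at a point of the fixed unit sphere of `ι` (where `D_n = 0`,
`inversionDefect_eq_zero_of_norm_eq_one`) the germ of `D_n` is ODD under `ι` to leading order: half of the
jet conditions in the residual stub are automatic. [folklore] -/
theorem inversionDefect_invCfg {n : ℕ} (Δ : ℝ) (S : CorrFamily 3) {x : Fin n → EuclideanSpace ℝ (Fin 3)}
    (hx : ∀ i, x i ≠ 0) :
    inversionDefect Δ S n (invCfg x) = -(∏ i, ‖invCfg x i‖ ^ (2 * Δ)) * inversionDefect Δ S n x := by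
  have hw := prod_norm_invCfg_rpow_mul Δ hx
  simp only [inversionDefect, invCfg_invCfg]
  linear_combination (-(S n x)) * hw

/-- **Inversion covariance of an analytic 1981-type limit from its even inversion germs.** If a normalised,
non-degenerate, translation-invariant, scale-covariant pointwise scaling limit `S` of the critical `ℤ³`
correlators is real-analytic on the good configurations and, at every even order `n ≥ 4`, every doubly-good
configuration is joined inside `InvGoodConfig n` to a zero of the germ of the inversion defect, then `S` is
inversion covariant with the same `Δ`: orders `< 4` and odd orders are free
(`inversionDefect_eq_zero_of_lt_four_or_odd`), continuity is mesh continuity, and the jet reduction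
(`stub_onePointJetReduction`) with the density theorem (`stub_invGoodConfig_dense`) does the rest. [folklore] -/
theorem isInversionCovariant_of_evenGerm {ρ : ℝ → ℝ} {Δ : ℝ} {S : CorrFamily 3}
    (hρ : ∀ δ ∈ Set.Ioc (0:ℝ) 1, 0 < ρ δ) (hlim : HasPointwiseScalingLimit (criticalCorr 3) ρ S)
    (hnorm : ∀ n z, z ∉ NonCoincident 3 n → S n z = 0) (hnd : IsNondegenerateTwoPoint S)
    (htr : IsTranslationInvariant S) (hsc : IsScaleCovariant Δ S)
    (han : ∀ n, AnalyticOnNhd ℝ (S n) (GoodConfig n))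
    (hgerm : ∀ n, 4 ≤ n → Even n → ∀ x ∈ InvGoodConfig n, ∃ x₀, JoinedIn (InvGoodConfig n) x x₀ ∧
      inversionDefect Δ S n =ᶠ[𝓝 x₀] 0) :
    IsInversionCovariant Δ S := by
  have hcont : ∀ n, ContinuousOn (S n) (NonCoincident 3 n) :=
    Summit.CriticalPhenomena.Ising3DConformalLimit.LimitMeshContinuity.continuousOn_limit_of_translationInvariant
      hlim htr
  refine stub_onePointJetReduction Δ S hnorm hcont han stub_invGoodConfig_dense ?_
  intro n x hx
  by_cases h4 : 4 ≤ n
  · by_cases he : Even n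
    · exact hgerm n h4 he x hx
    · refine ⟨x, JoinedIn.refl hx, ?_⟩
      filter_upwards [eventually_forall_ne_zero' hx.1] with y hy
      exact inversionDefect_eq_zero_of_lt_four_or_odd ρ Δ S hρ hlim hnorm hnd htr hsc n
        (Or.inr (Nat.not_even_iff_odd.1 he)) y hy
  · refine ⟨x, JoinedIn.refl hx, ?_⟩
    filter_upwards [eventually_forall_ne_zero' hx.1] with y hy
    exact inversionDefect_eq_zero_of_lt_four_or_odd ρ Δ S hρ hlim hnorm hnd htr hsc n (Or.inl (by omega)) y hy

/-- **The line's reduction (registered anchor `MoebiusLimitExists_of_analyticity_of_evenGerm`).** Nine-mirror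
analyticity (A) and the even inversion germs (G), both spelled out verbatim as the registered stub statements,
together with the existence item stmt-CriticalPhenomena-1981 `ExistsScaleCovariantLimit` BY NAME, give the crux
`PerfectScreening.MoebiusLimitExists`: the 1981 witness is continuous (mesh continuity), analytic by (A),
inversion covariant by `isInversionCovariant_of_evenGerm`, rotation invariant by inversion + translations
(item 4675, proved), hence Möbius covariant. No rotation item, no `HRP2Rigidity`. [folklore] -/
theorem MoebiusLimitExists_of_analyticity_of_evenGerm :
    (∀ (ρ : ℝ → ℝ) (Δ : ℝ) (S : CorrFamily 3), (∀ δ ∈ Set.Ioc (0:ℝ) 1, 0 < ρ δ) → 0 < Δ →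
      HasPointwiseScalingLimit (criticalCorr 3) ρ S →
      (∀ n z, z ∉ NonCoincident 3 n → S n z = 0) → IsNondegenerateTwoPoint S →
      IsTranslationInvariant S → IsScaleCovariant Δ S →
      (∀ n, ContinuousOn (S n) (NonCoincident 3 n)) →
      ∀ n, AnalyticOnNhd ℝ (S n) (GoodConfig n)) →
    (∀ (ρ : ℝ → ℝ) (Δ : ℝ) (S : CorrFamily 3), (∀ δ ∈ Set.Ioc (0:ℝ) 1, 0 < ρ δ) → 0 < Δ →
      HasPointwiseScalingLimit (criticalCorr 3) ρ S →
      (∀ n z, z ∉ NonCoincident 3 n → S n z = 0) → IsNondegenerateTwoPoint S →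
      IsTranslationInvariant S → IsScaleCovariant Δ S →
      (∀ n, ContinuousOn (S n) (NonCoincident 3 n)) →
      (∀ n, AnalyticOnNhd ℝ (S n) (GoodConfig n)) →
      ∀ n, 4 ≤ n → Even n → ∀ x ∈ InvGoodConfig n, ∃ x₀, JoinedIn (InvGoodConfig n) x x₀ ∧
        inversionDefect Δ S n =ᶠ[𝓝 x₀] 0) →
    Theses.HyperoctahedralRP.ExistsScaleCovariantLimit →
    Theses.PerfectScreening.MoebiusLimitExists := by
  intro hA hG hE
  obtain ⟨ρ, Δ, S, hρ, hΔ, hlim, hnorm, hnd, htr, hsc⟩ := hE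
  have hcont : ∀ n, ContinuousOn (S n) (NonCoincident 3 n) :=
    Summit.CriticalPhenomena.Ising3DConformalLimit.LimitMeshContinuity.continuousOn_limit_of_translationInvariant
      hlim htr
  have han : ∀ n, AnalyticOnNhd ℝ (S n) (GoodConfig n) := hA ρ Δ S hρ hΔ hlim hnorm hnd htr hsc hcont
  have hinv : IsInversionCovariant Δ S :=
    isInversionCovariant_of_evenGerm hρ hlim hnorm hnd htr hsc han
      (hG ρ Δ S hρ hΔ hlim hnorm hnd htr hsc hcont han)
  have hrot : IsRotationInvariant S :=
    Summit.CriticalPhenomena.Ising3DConformalLimit.PrecisionLaplacianMoebiusLimitOfTwoPointLaw.stub_inversionBegetsRotations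
      Δ S htr hinv
  exact ⟨ρ, Δ, S, hρ, hΔ, hlim, hnd, ⟨htr, hrot⟩, hsc, hinv⟩

/-- The same reduction under the primary route's spelling of the crux (`EnergyNotSigmaSquared.MoebiusLimit`,
item stmt-CriticalPhenomena-1344; one term). [folklore] -/
theorem MoebiusLimit_of_analyticity_of_evenGerm
    (hA : ∀ (ρ : ℝ → ℝ) (Δ : ℝ) (S : CorrFamily 3), (∀ δ ∈ Set.Ioc (0:ℝ) 1, 0 < ρ δ) → 0 < Δ →
      HasPointwiseScalingLimit (criticalCorr 3) ρ S →
      (∀ n z, z ∉ NonCoincident 3 n → S n z = 0) → IsNondegenerateTwoPoint S →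
      IsTranslationInvariant S → IsScaleCovariant Δ S →
      (∀ n, ContinuousOn (S n) (NonCoincident 3 n)) →
      ∀ n, AnalyticOnNhd ℝ (S n) (GoodConfig n))
    (hG : ∀ (ρ : ℝ → ℝ) (Δ : ℝ) (S : CorrFamily 3), (∀ δ ∈ Set.Ioc (0:ℝ) 1, 0 < ρ δ) → 0 < Δ →
      HasPointwiseScalingLimit (criticalCorr 3) ρ S →
      (∀ n z, z ∉ NonCoincident 3 n → S n z = 0) → IsNondegenerateTwoPoint S →
      IsTranslationInvariant S → IsScaleCovariant Δ S →
      (∀ n, ContinuousOn (S n) (NonCoincident 3 n)) →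
      (∀ n, AnalyticOnNhd ℝ (S n) (GoodConfig n)) →
      ∀ n, 4 ≤ n → Even n → ∀ x ∈ InvGoodConfig n, ∃ x₀, JoinedIn (InvGoodConfig n) x x₀ ∧
        inversionDefect Δ S n =ᶠ[𝓝 x₀] 0)
    (hE : Theses.HyperoctahedralRP.ExistsScaleCovariantLimit) :
    Theses.EnergyNotSigmaSquared.MoebiusLimit :=
  MoebiusLimitExists_of_analyticity_of_evenGerm hA hG hE

/-- **Under (A), the residual (G) is EXACTLY the crux given existence**: (G) is crux-implied
(`stub_inversionGerm_even_ge_four_of_crux`) and, with (A) and item 1981, implies the crux. [folklore] -/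
theorem evenGerm_iff_MoebiusLimitExists_of_analyticity
    (hA : ∀ (ρ : ℝ → ℝ) (Δ : ℝ) (S : CorrFamily 3), (∀ δ ∈ Set.Ioc (0:ℝ) 1, 0 < ρ δ) → 0 < Δ →
      HasPointwiseScalingLimit (criticalCorr 3) ρ S →
      (∀ n z, z ∉ NonCoincident 3 n → S n z = 0) → IsNondegenerateTwoPoint S →
      IsTranslationInvariant S → IsScaleCovariant Δ S →
      (∀ n, ContinuousOn (S n) (NonCoincident 3 n)) →
      ∀ n, AnalyticOnNhd ℝ (S n) (GoodConfig n))
    (hE : Theses.HyperoctahedralRP.ExistsScaleCovariantLimit) :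
    (∀ (ρ : ℝ → ℝ) (Δ : ℝ) (S : CorrFamily 3), (∀ δ ∈ Set.Ioc (0:ℝ) 1, 0 < ρ δ) → 0 < Δ →
      HasPointwiseScalingLimit (criticalCorr 3) ρ S →
      (∀ n z, z ∉ NonCoincident 3 n → S n z = 0) → IsNondegenerateTwoPoint S →
      IsTranslationInvariant S → IsScaleCovariant Δ S →
      (∀ n, ContinuousOn (S n) (NonCoincident 3 n)) →
      (∀ n, AnalyticOnNhd ℝ (S n) (GoodConfig n)) →
      ∀ n, 4 ≤ n → Even n → ∀ x ∈ InvGoodConfig n, ∃ x₀, JoinedIn (InvGoodConfig n) x x₀ ∧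
        inversionDefect Δ S n =ᶠ[𝓝 x₀] 0) ↔
    Theses.PerfectScreening.MoebiusLimitExists :=
  ⟨fun hG => MoebiusLimitExists_of_analyticity_of_evenGerm hA hG hE, stub_inversionGerm_even_ge_four_of_crux⟩

end Summit.CriticalPhenomena.Ising3DConformalLimit.MoebiusLimitExistsOneMapOneJet

end
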